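import Summits.HodgeConjecture.HodgeConjecture.Theses.FirstOrderSemiregularSeeds
import Summits.HodgeConjecture.HodgeConjecture.Theorems.FirstOrderSemiregularSeedsFirstOrderWeilSeedsEightCLfDesignPad4
import Literature.AlgebraicGeometry.Modules.SerreSubbundleOfTwists
import Literature.AlgebraicGeometry.HodgeTheory.WeilClassesFourfoldsProofs
import Literature.AlgebraicGeometry.Motives.AbelianVarietyProductDimProofs
import Literature.NumberTheory.EllipticCurves.CMEndomorphismOfMulMemLattice
import Literature.AlgebraicGeometry.HodgeTheory.HyperbolicWeilTypeExistence
import Literature.AlgebraicGeometry.HodgeTheory.ChernCharacterBettiSums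
import Literature.AlgebraicGeometry.KTheory.PullbackVectorBundle
import Mathlib.Tactic.Module
import HarnessLib
import HarnessLib.Audit

/-!
# Line `birthK` (BC3 / BC5 PLAN-ONLY skeleton, v5) — crux `FirstOrderSemiregularSeeds.FirstOrderWeilSeedsEightCS` (X2‴)
# (item stmt-HodgeConjecture-24864, route route-HodgeConjecture-FirstOrderSemiregularSeeds rev 10, d8a2f7c04624)
# tribunal-w planner `hodge-fos-w-1` g4, 2026-08-28.  Predecessor: `Lines/birthS.lean` v4 (one XL stub `stub_firstOrderLift_pad4_at`,
# "find ONE bundle passing the 16-row Atiyah test"; instrument status ≤ 9/16).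

HONEST FRAMING. Nothing in this file proves X2‴, X1, rung H2 (`SevenfoldWeilCensus.WeilSixfolds`), HC for abelian varieties or the
Hodge conjecture.  TWO statements are SORRIED STUBS (`stub_universalWeilThickening_pad4` = U, `stub_firstOrderKLift_abelian` = K);
everything else is proved here or in the tree.  The v4 rung `stub_firstOrderLift_pad4_at` is NOT claimed; it FOLLOWS from U ∧ K ∧ Serre
(this file), which is the point of v5: the lift half of X2‴ is REDUCED to (U) the geometry of the universal first-order Weil thickening
— standard moduli / Hodge-locus / torsor facts, no search — and (K) a FIRST-ORDER K-THEORETIC DEFORMATIONAL HODGE statement on abelian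
fibres whose one-parameter case is IN PRINT for the genuine Chern character (Bloch–Esnault–Kerz 2014 Thm. 2 with Rem. 1 (CK for abelian
schemes, Deninger–Murre) — arXiv:1310.1773 p. 3; Morrow 2014 Thm. 1.1 — arXiv:1310.1900 p. 5) and whose multi-parameter case (needed:
the Weil family is 16-dimensional and the first-order clause wants ONE bundle for all 16 directions) is the one genuine extrapolation
(memo `LIFT-HALF-K-THEORY.md` §1: Goodwillie + pro-HKR are general; Morrow's Lemma 3.1 is the only t-adic step; BEK's levelwise
Milnor-K obstruction calculus is Artinian-general).  NO 16/16 design is claimed or needed on this line: the instrument question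
"which single bundle passes all 16 rows" is replaced by "K₀ of the universal square-zero thickening contains a class restricting to
N·[E] modulo ker ch", which the cited theorems answer direction by direction.

Crux (VERBATIM the route decl, concluded BY NAME below): `FirstOrderWeilSeedsEightCS` — `Hartshorne1977_serre_subbundleOfTwists →
∀ C d, 0 < d → HasHyperbolicSeedOn 𝒪_C 4 d`; `𝒪_C` = `foClass C` (same lambda as the route; `firstOrderWeilSeedsEightCS_iff` is `Iff.rfl`).

## The line (composition `FirstOrderWeilSeedsEightCS_of`, sorry-free)
CM curve (`exists_cmCurve_sqrt_neg`) → anchor `S_d⁴ ≅ E₀⁸` (§1) → CLASS HALF in the tree modulo Serre (`kappaDesign_pad4_of_serre'`: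
datum `(e, a, w)` + f.l.f. `E` with `ch₄ = q h⁴ + w`, `ch_p = c_p hᵖ`) → U gives the universal first-order Weil thickening
`ι : P ↪ 𝒳_A → Spec A` (A = `𝒪_{W,P}/m²`) inside a smooth family over the Weil locus on which `ℚ[h] ⊕ W_K` stays Hodge → K AT THAT DATUM
gives f.l.f. `Fp, Fm` on `𝒳_A` with `ch(ι^*Fp) − ch(ι^*Fm) = N·ch(E)` → Serre (the route's own antecedent K-S) ON THE THICKENING puts
`Fm ↪ (e_A^*L₀)^{⊕(k+1)}` with f.l.f. quotient `Q` → `G := Fp ⊞ Q` (⊞ the padding line bundle `𝓛` of U when the `h¹`-coefficient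
cancels) is a vector bundle ON THE THICKENING with `ch(ι^*G) = N·ch(E) + (pure ℚ[h])`, Weil part `N·w ≠ 0`, `h¹`-coefficient `≠ 0`
→ U's universal-lift clause gives the route's first-order clause for `E' := ι^*G` → `HasSeedOn (foClass C) 4 …` → the crux BY NAME.

## Why-clause (tribunal T3 / BC5 — still PLAN-ONLY; designate moves to `stub_firstOrderKLift_abelian`)
RUNG DESIGNATE = K.  Its ONE-PARAMETER case (base a smooth curve, genuine `ch`) is BEK 2014 Thm. 2 + Rem. 1 + "K₀ is generated by
bundles" — a published theorem in a regime where S (HC for Weil-type sixfolds / abelian varieties) is open; it exercises exactly the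
route's lever (first-order admissibility discharged by K-THEORETIC deformation of classes instead of deformation of ONE sheaf, which is
where σ-injectivity / the 16-row test got stuck).  WHY NOT S: K is a statement about ONE square-zero thickening of ONE abelian variety and
Chern characters; it says nothing about algebraicity at the generic Weil fibre (that is X1's transfer + the amplification chain).
Named technique for the multi-parameter case: Goodwillie's theorem (relative K ≅ relative HC for nilpotent ideals) + Morrow's pro-HKR
(arXiv:1310.1900 Thm. 2.1/Cor. 2.2, general regular immersions) + flatness of the Hodge classes to all orders along the Weil locus
(reduced base) — or BEK §5's levelwise obstruction `Ob(ξ) ∈ H^{i+1}(X₁, Ω^{i-1}_{X₁}) ⊗ 𝔪` killed by Kodaira–Spencer ∘ (Hodge condition)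
and Chow–Künneth projectors, which is Artinian-general.

## Registered stubs (sorried; a prover closes one with `propose --supports stmt-HodgeConjecture-24864` BY NAME + SIGNATURE)
* `stub_universalWeilThickening_pad4` (U) — size L/XL (formalisation-heavy, mathematically standard).  Content: the PEL/Weil locus
  `W ∋ P` (smooth, 16-dim, level structure), its universal abelian scheme, `HL(h, w') = Ŵ` as FORMAL SUBSCHEMES of `Def(P,0)` (tangent
  computation `{ξ : ξ·h = 0, ξ·w' = 0} = S²_h ∩ C(ψ) = T_P W`, both 16-dim, `W` smooth), projectivity of the first-order thickening via a
  lift of `L_h^{⊗m}` (so ambient line bundles restrict into `ℚ[h]`, for EVERY `C` by functoriality through `ℙ^M`), `μ₁(C) ≠ 0`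
  (`C.ch₁(𝒪_ℙ(1)) ≠ 0`, from the span axiom on `ℙ¹`), and the torsor lemma for square-zero lifts (`Def_{E'}(A') ` is an
  `H¹(End E') ⊗ 𝔪_{A'}`-torsor compatibly with `A' ↠ B'`).  WHY IT MIGHT FAIL: only through a mismatch between the typed telescope
  (`IsSmoothProjectiveFamily`, `IsCohomologicallyLocallyTrivialOn`, `specOver`, pull-back squares) and the intended geometry.
  Sources: vanGeemen1994HodgeAV 5.2–5.4 (T_W, hyperbolic type); VoisinHodgeII 5.3 (Hodge loci); Sernesi2006Deformations 2.4–3.3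
  (torsors, square-zero); MumfordAV1970 §16/§23 (polarisations); FaltingsChai1990 I.4 (moduli smooth).
* `stub_firstOrderKLift_abelian` (K) — **THE RUNG DESIGNATE and the HARDEST stub**.  Size XL.  WHY IT MIGHT FAIL: (i) multi-parameter
  bases are NOT covered verbatim in print (Morrow's Lemma 3.1 is t-adic; a filtered Gauss–Manin lifting lemma / BEK's levelwise route is
  needed); (ii) it is stated for EVERY `C : ChernCharacterBetti` (as X1/X2‴ are) while the theorems are about the genuine `ch`;
  (iii) over `ℂ` (not `ℚ̄`) BEK need Chow–Künneth projectors to kill `ker σ` — fine for abelian schemes (Deninger–Murre) after an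
  étale-local section.  Sources: BlochEsnaultKerz2014CharZero Thm. 2, Rem. 1, Rem. 3, §5, App. A Prop. 31; Morrow2014DeformationalHodge
  Thm. 1.1, Thm. 3.2, Cor. 2.2; GreenGriffiths2005 (ν-obstruction); DeningerMurre1991 Thm. 3.1.

## Disproof / negatives used
No `Disproof.lean` exists for X2′/X2″/X2‴.  `ledger negatives --problem HodgeConjecture`: none concerns semiregularity, first-order
lifting, K-theoretic lifting, Weil type or Serre's theorems.  Dead sub-lines honoured: no coordinate/⊕/box-product/semi-homogeneous/
Poincaré/FM-kernel design is proposed (all killed by R1–R3 + j292340 + the pre-filter `ch ∉ ℚ[h] ⊕ W`); no per-direction bundle is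
summed (each summand would have to lift in every direction): the K-lift is taken on the UNIVERSAL 16-parameter thickening.

## References
[cite: BlochEsnaultKerz2014CharZero, Thm. 2, Rem. 1, Rem. 3, Q 5, §5 Lemma 24–Thm. 25, Thm. 29, App. A Prop. 31]
[cite: Morrow2014DeformationalHodge, Thm. 1.1, Thm. 2.1, Cor. 2.2, Lemma 3.1, Thm. 3.2] [cite: Hartshorne1977, II Thm. 5.17 p. 153, II Ex. 5.1]
[cite: Fulton1998, Ex. 3.2.3, §15.1] [cite: vanGeemen1994HodgeAV, 4.3, 5.2–5.4] [cite: MumfordAV1970, §1 (3), §16]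
[cite: Markman2025SurveySecant, Q 11.4, Lemma 11.3] [cite: BuchweitzFlenner2003, §4–§5] [cite: FantechiManetti1999T1Lifting, Thm. A]
-/

noncomputable section

-- single-problem summit (Problem = Summit): the mandated namespace repeats `HodgeConjecture`.
set_option linter.dupNamespace false

open CategoryTheory CategoryTheory.Limits AlgebraicGeometry
open Literature.AlgebraicGeometry Literature.AlgebraicGeometry.Motives Literature.AlgebraicGeometry.HodgeTheory
open Literature.AlgebraicGeometry.Modules Literature.AlgebraicGeometry.KTheory
open Literature.AlgebraicTopology.SingularHomology
open Summit.Ventures.HSemireg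

namespace Summit.HodgeConjecture.HodgeConjecture.Cruxes.FirstOrderWeilSeedsEightCS.BirthK

/-! ## §0 The object class `𝒪_C` named (verbatim the route lambda), its class half, its first-order clause -/

/-- **`𝒪_C` NAMED** — VERBATIM the object class inlined in the route decls `FirstOrderSemiregularTransfer` /
`FirstOrderWeilSeedsEightCS` (as in `Lines/birthS.lean`; `firstOrderWeilSeedsEightCS_iff` checks the copy by `Iff.rfl`).
[cite: Markman2025SurveySecant, Q 11.4 (first-order reading)] [cite: FantechiManetti1999T1Lifting, §1] -/
def foClass (C : ChernCharacterBetti) : ObjClass :=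
  fun (n : ℕ) (X₀ : Literature.AlgebraicGeometry.Motives.SchemeOver ℂ) (I : Finset ℕ) (κ : (p : ℕ) → Literature.AlgebraicGeometry.HodgeTheory.complexBetti X₀ (2 * p)) => I = Finset.range (n + 1) ∧ (∃ P₀ : Literature.AlgebraicGeometry.Motives.AbelianVariety ℂ, Nonempty (X₀ ≅ P₀.X)) ∧ ∃ (E₀ : X₀.left.Modules) (_ : Literature.AlgebraicGeometry.Motives.IsFiniteLocallyFree E₀), (∀ p ∈ I, κ p = C.ch X₀ E₀ p) ∧ ∀ ⦃𝒳 S : Literature.AlgebraicGeometry.Motives.SchemeOver ℂ⦄ (π : 𝒳 ⟶ S), Literature.AlgebraicGeometry.Motives.IsSmoothProjectiveFamily π n → AlgebraicGeometry.Smooth S.hom → ∀ ⦃U : Set (Literature.AlgebraicGeometry.Motives.ComplexPoints S)⦄ (hU : Literature.AlgebraicGeometry.HodgeTheory.IsCohomologicallyLocallyTrivialOn π U) (s₀ : U) (e : X₀ ≅ Literature.AlgebraicGeometry.Motives.fiberOver π s₀.1), (∀ p ∈ Finset.range (n + 1), ∀ (t : U) (γ : Path.Homotopic.Quotient s₀ t),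 Literature.AlgebraicGeometry.HodgeTheory.IsOfHodgeType n (Literature.AlgebraicGeometry.Motives.fiberOver π t.1) (2 * p) p p (Literature.AlgebraicGeometry.HodgeTheory.transportFun π (2 * p) hU γ (Literature.AlgebraicGeometry.HodgeTheory.complexBetti.map e.inv (2 * p) (C.ch X₀ E₀ p)))) → ∀ (A B : Type) [CommRing A] [Algebra ℂ A] [IsArtinianRing A] [IsLocalRing A] [CommRing B] [Algebra ℂ B] (f : A →ₐ[ℂ] B), Function.Surjective f → IsLocalRing.maximalIdeal A * IsLocalRing.maximalIdeal A = ⊥ → ∀ (ρ : B →ₐ[ℂ] ℂ) (a : Literature.AlgebraicGeometry.Motives.specOver ℂ A ⟶ S), CategoryTheory.CategoryStruct.comp (AlgebraicGeometry.Spec.map (CommRingCat.ofHom (ρ.comp f).toRingHom)) a.left = s₀.1.left → ∀ ⦃XA XB : AlgebraicGeometry.Scheme⦄ (gA : XA ⟶ 𝒳.left) (qA : XA ⟶ AlgebraicGeometry.Spec (CommRingCat.of A)), CategoryTheory.IsPullback gA qA π.left a.left → ∀ (i : XB ⟶ XA) (qB : XB ⟶ AlgebraicGeometry.Spec (CommRingCat.of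 B)), CategoryTheory.IsPullback i qB qA (AlgebraicGeometry.Spec.map (CommRingCat.ofHom f.toRingHom)) → ∀ (j : X₀.left ⟶ XB), CategoryTheory.IsPullback j X₀.hom qB (AlgebraicGeometry.Spec.map (CommRingCat.ofHom ρ.toRingHom)) → CategoryTheory.CategoryStruct.comp j (CategoryTheory.CategoryStruct.comp i gA) = CategoryTheory.CategoryStruct.comp e.hom.left (Literature.AlgebraicGeometry.Motives.fiberι π s₀.1).left → ∀ (F : XB.Modules), Literature.AlgebraicGeometry.Motives.IsVectorBundle F → Nonempty ((AlgebraicGeometry.Scheme.Modules.pullback j).obj F ≅ E₀) → Literature.AlgebraicGeometry.Deformation.LiftsAlong i F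

/-- **The CLASS HALF of `𝒪_C`** (first-order clause deleted), as in `Lines/birthS.lean`. [cite: BuchweitzFlenner2003, §5] -/
def lfDesignClass (C : ChernCharacterBetti) : ObjClass :=
  fun (n : ℕ) (X₀ : Literature.AlgebraicGeometry.Motives.SchemeOver ℂ) (I : Finset ℕ) (κ : (p : ℕ) → Literature.AlgebraicGeometry.HodgeTheory.complexBetti X₀ (2 * p)) => I = Finset.range (n + 1) ∧ (∃ P₀ : Literature.AlgebraicGeometry.Motives.AbelianVariety ℂ, Nonempty (X₀ ≅ P₀.X)) ∧ ∃ (E₀ : X₀.left.Modules) (_ : Literature.AlgebraicGeometry.Motives.IsFiniteLocallyFree E₀), (∀ p ∈ I, κ p = C.ch X₀ E₀ p)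

/-- **The FIRST-ORDER LIFT CLAUSE of `𝒪_C` for `(X₀, E₀)` in relative dimension `n`** — VERBATIM the tail of `foClass` after
`(∀ p ∈ I, κ p = C.ch X₀ E₀ p) ∧`: along every smooth projective family through `X₀` over a smooth base on which all `ch_p(E₀)`
(`p ≤ n`) stay of Hodge type over a cohomologically locally trivial open `U ∋ s₀`, `E₀` lifts along every square-zero Artinian
point `Spec B ↪ Spec A → S` centred at `s₀`. [cite: FantechiManetti1999T1Lifting, §1] [cite: Markman2025SurveySecant, Q 11.4] -/
def foLift (C : ChernCharacterBetti) (n : ℕ) (X₀ : SchemeOver ℂ) (E₀ : X₀.left.Modules) : Prop :=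
  ∀ ⦃𝒳 S : Literature.AlgebraicGeometry.Motives.SchemeOver ℂ⦄ (π : 𝒳 ⟶ S), Literature.AlgebraicGeometry.Motives.IsSmoothProjectiveFamily π n → AlgebraicGeometry.Smooth S.hom → ∀ ⦃U : Set (Literature.AlgebraicGeometry.Motives.ComplexPoints S)⦄ (hU : Literature.AlgebraicGeometry.HodgeTheory.IsCohomologicallyLocallyTrivialOn π U) (s₀ : U) (e : X₀ ≅ Literature.AlgebraicGeometry.Motives.fiberOver π s₀.1), (∀ p ∈ Finset.range (n + 1), ∀ (t : U) (γ : Path.Homotopic.Quotient s₀ t), Literature.AlgebraicGeometry.HodgeTheory.IsOfHodgeType n (Literature.AlgebraicGeometry.Motives.fiberOver π t.1) (2 * p) p p (Literature.AlgebraicGeometry.HodgeTheory.transportFun π (2 * p) hU γ (Literature.AlgebraicGeometry.HodgeTheory.complexBetti.map e.inv (2 * p) (C.ch X₀ E₀ p)))) → ∀ (A B : Type) [CommRing A] [Algebra ℂ A] [IsArtinianRing A] [IsLocalRing A] [CommRing B] [Algebra ℂ B] (f : A →ₐ[ℂ] B), Function.Surjective f → IsLocalRing.maximalIdeal A * IsLocalRing.maximalIdeal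 A = ⊥ → ∀ (ρ : B →ₐ[ℂ] ℂ) (a : Literature.AlgebraicGeometry.Motives.specOver ℂ A ⟶ S), CategoryTheory.CategoryStruct.comp (AlgebraicGeometry.Spec.map (CommRingCat.ofHom (ρ.comp f).toRingHom)) a.left = s₀.1.left → ∀ ⦃XA XB : AlgebraicGeometry.Scheme⦄ (gA : XA ⟶ 𝒳.left) (qA : XA ⟶ AlgebraicGeometry.Spec (CommRingCat.of A)), CategoryTheory.IsPullback gA qA π.left a.left → ∀ (i : XB ⟶ XA) (qB : XB ⟶ AlgebraicGeometry.Spec (CommRingCat.of B)), CategoryTheory.IsPullback i qB qA (AlgebraicGeometry.Spec.map (CommRingCat.ofHom f.toRingHom)) → ∀ (j : X₀.left ⟶ XB), CategoryTheory.IsPullback j X₀.hom qB (AlgebraicGeometry.Spec.map (CommRingCat.ofHom ρ.toRingHom)) → CategoryTheory.CategoryStruct.comp j (CategoryTheory.CategoryStruct.comp i gA) = CategoryTheory.CategoryStruct.comp e.hom.left (Literature.AlgebraicGeometry.Motives.fiberι π s₀.1).left → ∀ (F : XB.Modules), Literature.AlgebraicGeometry.Motives.IsVectorBundle F → Nonempty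 ((AlgebraicGeometry.Scheme.Modules.pullback j).obj F ≅ E₀) → Literature.AlgebraicGeometry.Deformation.LiftsAlong i F

/-- The route crux X2‴ IS `Serre → ∀ C d, 0 < d → HasHyperbolicSeedOn (foClass C) 4 d` — definitionally. -/
theorem firstOrderWeilSeedsEightCS_iff :
    Summit.HodgeConjecture.HodgeConjecture.Theses.FirstOrderSemiregularSeeds.FirstOrderWeilSeedsEightCS ↔
      (Hartshorne1977_serre_subbundleOfTwists →
        ∀ C : ChernCharacterBetti, ∀ d : ℕ, 0 < d → HasHyperbolicSeedOn (foClass C) 4 d) :=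
  Iff.rfl

/-- `𝒪_C`-admissibility = class half + first-order clause (introduction rule). [folklore] -/
theorem foClass_intro (C : ChernCharacterBetti) {n : ℕ} {X₀ : SchemeOver ℂ} {I : Finset ℕ}
    {κ : (p : ℕ) → complexBetti X₀ (2 * p)} (hI : I = Finset.range (n + 1))
    (hab : ∃ P₀ : AbelianVariety ℂ, Nonempty (X₀ ≅ P₀.X)) {E₀ : X₀.left.Modules} (hE₀ : IsFiniteLocallyFree E₀)
    (hκ : ∀ p ∈ I, κ p = C.ch X₀ E₀ p) (hlift : foLift C n X₀ E₀) : foClass C n X₀ I κ :=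
  ⟨hI, hab, E₀, hE₀, hκ, hlift⟩

/-! ## §1 The named anchor `S_d⁴`, `S_d = E₀ × E₀`, `φ = ψ₀ × (−ψ₀)`, `ψ₀ ≫ ψ₀ = -d` (as in `Lines/birthS.lean`) -/

section Anchor

variable (E₀ : AbelianVariety ℂ) (ψ₀ : E₀ ⟶ E₀)

/-- The Weil surface `S = E₀ × E₀`. -/
abbrev weilSurf : AbelianVariety ℂ := E₀.prod E₀

/-- Its Weil action `φ_S = ψ₀ × (−ψ₀)`. -/
abbrev weilSurfAct : weilSurf E₀ ⟶ weilSurf E₀ :=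
  AbelianVariety.prodLift (AbelianVariety.fst E₀ E₀ ≫ ψ₀) (AbelianVariety.snd E₀ E₀ ≫ (-ψ₀))

/-- `S² = S × S`. -/
abbrev pad2Anchor : AbelianVariety ℂ := (weilSurf E₀).prod (weilSurf E₀)
/-- `S³ = S² × S`. -/
abbrev pad3Anchor : AbelianVariety ℂ := (pad2Anchor E₀).prod (weilSurf E₀)
/-- **The PAD-4 anchor** `S⁴ = S³ × S` (`≅ E₀⁸`; Weil structure `(√-d, −√-d)⁴`, signature `(4,4)`). -/
abbrev pad4Anchor : AbelianVariety ℂ := (pad3Anchor E₀).prod (weilSurf E₀)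

/-- Product action on `S²`. -/
abbrev pad2Action : pad2Anchor E₀ ⟶ pad2Anchor E₀ :=
  AbelianVariety.prodLift (AbelianVariety.fst _ _ ≫ weilSurfAct E₀ ψ₀) (AbelianVariety.snd _ _ ≫ weilSurfAct E₀ ψ₀)
/-- Product action on `S³`. -/
abbrev pad3Action : pad3Anchor E₀ ⟶ pad3Anchor E₀ :=
  AbelianVariety.prodLift (AbelianVariety.fst _ _ ≫ pad2Action E₀ ψ₀) (AbelianVariety.snd _ _ ≫ weilSurfAct E₀ ψ₀)
/-- **The PAD-4 action** `ψ = φ_S⁴` on `S⁴`. -/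
abbrev pad4Action : pad4Anchor E₀ ⟶ pad4Anchor E₀ :=
  AbelianVariety.prodLift (AbelianVariety.fst _ _ ≫ pad3Action E₀ ψ₀) (AbelianVariety.snd _ _ ≫ weilSurfAct E₀ ψ₀)

/-- The `K`-symmetrised hyperplane class `h_K(d, e, a) = d·ι^*a + ψ^*ι^*a` (the literal shape inside `HasHyperbolicSeedOn 𝒪 4 d`). -/
abbrev symH (d : ℕ) {P : AbelianVariety ℂ} (ψ : P ⟶ P) (e : ProjectiveEmbedding P.X)
    (a : complexBetti (projectiveSpace e.n ℂ) 2) : complexBetti P.X 2 :=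
  (d : ℂ) • complexBetti.map e.ι 2 a + complexBetti.map ψ.hom.hom.hom 2 (complexBetti.map e.ι 2 a)

variable {E₀ ψ₀}

/-- `dim S = 2·1`. -/
theorem weilSurf_dim (hE : E₀.dim = 1) : (weilSurf E₀).dim = 2 * 1 := by
  show (E₀.prod E₀).dim = 2 * 1
  rw [AbelianVariety.dim_prod, hE]

/-- `dim S⁴ = 2·4`. -/
theorem pad4Anchor_dim (hE : E₀.dim = 1) : (pad4Anchor E₀).dim = 2 * 4 := by
  have h1 := weilSurf_dim hE
  have h2 : (pad2Anchor E₀).dim = 2 * (1 + 1) := dim_prod_eq_two_mul h1 h1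
  have h3 : (pad3Anchor E₀).dim = 2 * ((1 + 1) + 1) := dim_prod_eq_two_mul h2 h1
  have h4 : (pad4Anchor E₀).dim = 2 * (((1 + 1) + 1) + 1) := dim_prod_eq_two_mul h3 h1
  simpa using h4

/-- `(−ψ₀)² = ψ₀²`. -/
theorem neg_comp_neg_eq {d : ℕ} (hψ : ψ₀ ≫ ψ₀ = -(d • 𝟙 E₀)) : (-ψ₀) ≫ (-ψ₀) = -(d • 𝟙 E₀) := by
  rw [Preadditive.neg_comp_neg]; exact hψ

/-- `φ_S ≫ φ_S = -d`. -/
theorem weilSurfAct_comp_self {d : ℕ} (hψ : ψ₀ ≫ ψ₀ = -(d • 𝟙 E₀)) :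
    weilSurfAct E₀ ψ₀ ≫ weilSurfAct E₀ ψ₀ = -(d • 𝟙 (weilSurf E₀)) :=
  prodLift_comp_self_eq_neg_nsmul hψ (neg_comp_neg_eq hψ)

/-- **`ψ ≫ ψ = -d` on `S⁴`.** -/
theorem pad4Action_comp_self {d : ℕ} (hψ : ψ₀ ≫ ψ₀ = -(d • 𝟙 E₀)) :
    pad4Action E₀ ψ₀ ≫ pad4Action E₀ ψ₀ = -(d • 𝟙 (pad4Anchor E₀)) := by
  have hS := weilSurfAct_comp_self hψ
  have h2 : pad2Action E₀ ψ₀ ≫ pad2Action E₀ ψ₀ = -(d • 𝟙 (pad2Anchor E₀)) :=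
    prodLift_comp_self_eq_neg_nsmul hS hS
  have h3 : pad3Action E₀ ψ₀ ≫ pad3Action E₀ ψ₀ = -(d • 𝟙 (pad3Anchor E₀)) :=
    prodLift_comp_self_eq_neg_nsmul h2 hS
  exact prodLift_comp_self_eq_neg_nsmul h3 hS

end Anchor

/-! ## §2 The CLASS HALF — IN THE TREE modulo the displayed Serre fact (hodge-fos-kappa-p1 p597041); one-line citation -/

/-- **The CLASS HALF (datum + f.l.f. κ-design on the pinned anchor, for every `C`, `d`, CM datum), MODULO SERRE** —
`Theorems.kappaDesign_pad4_of_serre` with `𝒪 := lfDesignClass C`, `Ψ := pad4Action E₀ ψ₀`, `rfl`. [cite: Hartshorne1977, II Thm. 5.17] -/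
theorem kappaDesign_pad4_of_serre' (hS : Hartshorne1977_serre_subbundleOfTwists) :
    ∀ (C : ChernCharacterBetti) (d : ℕ), 0 < d →
      ∀ (E₀ : AbelianVariety ℂ) (ψ₀ : E₀ ⟶ E₀), E₀.dim = 1 → ψ₀ ≫ ψ₀ = -(d • 𝟙 E₀) →
      ∃ (e : ProjectiveEmbedding (pad4Anchor E₀).X) (a : complexBetti (projectiveSpace e.n ℂ) 2)
      (w : complexBetti (pad4Anchor E₀).X (2 * 4)),
      IsRationalClass a ∧ a ≠ 0 ∧
      IsHyperbolicWeilType (pad4Anchor E₀) (pad4Action E₀ ψ₀) 4 (symH d (pad4Action E₀ ψ₀) e a) ∧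
      w ∈ weilClassesOf (pad4Anchor E₀) (pad4Action E₀ ψ₀) 4 d ∧ IsRationalClass w ∧ w ≠ 0 ∧
      HasSeedOn (lfDesignClass C) 4 (pad4Anchor E₀) (symH d (pad4Action E₀ ψ₀) e a) w :=
  fun C _d hd E₀ ψ₀ hE hψ =>
    Summit.HodgeConjecture.HodgeConjecture.Theorems.kappaDesign_pad4_of_serre hS C (lfDesignClass C)
      (fun _ _ _ h₁ h₂ h₃ => ⟨h₁, h₂, h₃⟩) hd hE hψ (pad4Action E₀ ψ₀) rfl

/-! ## §3 Registered stubs -/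

/-- **STUB U — the UNIVERSAL FIRST-ORDER WEIL THICKENING of the anchor** (mathematically standard, formalisation-heavy).
For every `C`, `d > 0`, CM datum and hyperbolic `(e, a)`: there is a smooth projective family `π : 𝒳 → S` of relative dimension 8 over
a SMOOTH base (the Weil/PEL locus with level structure), a cohomologically locally trivial open `U ∋ s₀` with `P := S_d⁴ ≅ X_{s₀}`,
such that (H1) every rational multiple of every power of `h_K` and (H2) every `q·h_K⁴ + w'`, `w'` in the `√-d`-Weil space, stay of
Hodge type under transport over `U`; a square-zero Artinian point `Spec A → S` centred at `s₀` (A = `𝒪_{W,P}/𝔪²`, all 16 directions)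
with its thickening `ι : P ↪ 𝒳_A` (pull-back squares as in the route's telescope) carrying a projective embedding `e_A` for which
(LB) every rank-`≤ 1` locally free `L₀` on the ambient `ℙ` restricts to `P` with `C.ch_p ∈ ℚ·h_Kᵖ` (embed by a lift of `L_{h_K}^{⊗m}`;
pure-`h` for EVERY `C` by functoriality through `ℙ`), (PAD) a finite locally free `𝓛` on `𝒳_A` with `C.ch_p(ι^*𝓛) = l_p·h_Kᵖ`,
`l₁ ≠ 0` (`𝓛 = e_A^*𝒪(1)`; `C.ch₁(𝒪_ℙ(1)) ≠ 0` by the span axiom on `ℙ¹`), and (UL) the UNIVERSAL-LIFT clause: every vector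
bundle `G` ON THE THICKENING whose restriction has `C.ch₄ = q'h⁴ + w'` (`w'` a non-zero rational Weil class), `C.ch_p = c'_p hᵖ`
(`p ≤ 8`, `p ≠ 4`) and `c'₁ ≠ 0` has a restriction `ι^*G` satisfying the route's first-order clause `foLift` — because the Hodge
locus germ `HL(h, w') ⊂ Def(P, 0)` IS the formal Weil germ `Ŵ` (tangent spaces `S²_h ∩ C(ψ) = T_P W`, both 16-dimensional, `W`
smooth), so every square-zero family of the clause is pulled back from `𝒳_A`, and lifts of a given `F` over `B` form a torsor under
`H¹(End ι^*G) ⊗ 𝔪` compatibly with `A ↠ B`.  Size L/XL.  Why it might fail / sources: module docstring.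
[cite: vanGeemen1994HodgeAV, 5.2–5.4] [cite: MumfordAV1970, §16] [cite: FantechiManetti1999T1Lifting, Thm. A] -/
theorem stub_universalWeilThickening_pad4 :
    ∀ (C : ChernCharacterBetti) (d : ℕ), 0 < d →
      ∀ (E₀ : AbelianVariety ℂ) (ψ₀ : E₀ ⟶ E₀), E₀.dim = 1 → ψ₀ ≫ ψ₀ = -(d • 𝟙 E₀) →
      ∀ (e : ProjectiveEmbedding (pad4Anchor E₀).X) (a : complexBetti (projectiveSpace e.n ℂ) 2),
      IsRationalClass a → a ≠ 0 →
      IsHyperbolicWeilType (pad4Anchor E₀) (pad4Action E₀ ψ₀) 4 (symH d (pad4Action E₀ ψ₀) e a) →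
      ∃ (𝒳 S : SchemeOver ℂ) (π : 𝒳 ⟶ S) (_ : IsSmoothProjectiveFamily π (2 * 4)) (_ : Smooth S.hom)
        (U : Set (ComplexPoints S)) (hU : IsCohomologicallyLocallyTrivialOn π U) (s₀ : U)
        (eW : (pad4Anchor E₀).X ≅ fiberOver π s₀.1)
        (A : Type) (_ : CommRing A) (_ : Algebra ℂ A) (_ : IsArtinianRing A) (_ : IsLocalRing A)
        (_ : IsLocalRing.maximalIdeal A * IsLocalRing.maximalIdeal A = ⊥)
        (ρ : A →ₐ[ℂ] ℂ) (aS : specOver ℂ A ⟶ S)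
        (_ : Spec.map (CommRingCat.ofHom ρ.toRingHom) ≫ aS.left = s₀.1.left)
        (𝒳A : SchemeOver ℂ) (gA : 𝒳A.left ⟶ 𝒳.left) (qA : 𝒳A.left ⟶ Spec (CommRingCat.of A))
        (_ : IsPullback gA qA π.left aS.left)
        (ι : (pad4Anchor E₀).X ⟶ 𝒳A)
        (_ : IsPullback ι.left (pad4Anchor E₀).X.hom qA (Spec.map (CommRingCat.ofHom ρ.toRingHom)))
        (_ : ι.left ≫ gA = eW.hom.left ≫ (fiberι π s₀.1).left)
        (eA : ProjectiveEmbedding 𝒳A) (𝓛 : 𝒳A.left.Modules) (_ : IsFiniteLocallyFree 𝓛) (l : ℕ → ℚ),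
        -- (H1) rational multiples of powers of `h_K` stay of Hodge type along `π` over `U`
        (∀ (p : ℕ) (c : ℚ) (t : U) (γ : Path.Homotopic.Quotient s₀ t),
          IsOfHodgeType (2 * 4) (fiberOver π t.1) (2 * p) p p
            (transportFun π (2 * p) hU γ (complexBetti.map eW.inv (2 * p)
              (((c : ℚ) : ℂ) • cupPowTwo (symH d (pad4Action E₀ ψ₀) e a) p)))) ∧
        -- (H2) `q·h_K⁴ + w'`, `w'` a `√-d`-Weil class, stays of Hodge type along `π` over `U`
        (∀ (q : ℚ) (w' : complexBetti (pad4Anchor E₀).X (2 * 4)),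
          w' ∈ weilClassesOf (pad4Anchor E₀) (pad4Action E₀ ψ₀) 4 d →
          ∀ (t : U) (γ : Path.Homotopic.Quotient s₀ t),
          IsOfHodgeType (2 * 4) (fiberOver π t.1) (2 * 4) 4 4
            (transportFun π (2 * 4) hU γ (complexBetti.map eW.inv (2 * 4)
              (((q : ℚ) : ℂ) • cupPowTwo (symH d (pad4Action E₀ ψ₀) e a) 4 + w')))) ∧
        -- (LB) ambient rank-≤1 bundles restrict into `ℚ[h_K]`
        (∀ (L₀ : (projectiveSpace eA.n ℂ).left.Modules), HasRankLE L₀ 1 →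
          ∃ c' : ℕ → ℚ, ∀ p : ℕ,
            C.ch (pad4Anchor E₀).X ((Scheme.Modules.pullback ι.left).obj ((Scheme.Modules.pullback eA.ι.left).obj L₀)) p =
              ((c' p : ℚ) : ℂ) • cupPowTwo (symH d (pad4Action E₀ ψ₀) e a) p) ∧
        -- (PAD) the padding line bundle
        (∀ p : ℕ, C.ch (pad4Anchor E₀).X ((Scheme.Modules.pullback ι.left).obj 𝓛) p =
          ((l p : ℚ) : ℂ) • cupPowTwo (symH d (pad4Action E₀ ψ₀) e a) p) ∧ l 1 ≠ 0 ∧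
        -- (UL) universal lift
        (∀ (G : 𝒳A.left.Modules), IsFiniteLocallyFree G →
          (∃ (q' : ℚ) (c' : ℕ → ℚ) (w' : complexBetti (pad4Anchor E₀).X (2 * 4)),
            w' ∈ weilClassesOf (pad4Anchor E₀) (pad4Action E₀ ψ₀) 4 d ∧ IsRationalClass w' ∧ w' ≠ 0 ∧
            C.ch (pad4Anchor E₀).X ((Scheme.Modules.pullback ι.left).obj G) 4 =
              ((q' : ℚ) : ℂ) • cupPowTwo (symH d (pad4Action E₀ ψ₀) e a) 4 + w' ∧
            (∀ p ∈ Finset.range (2 * 4 + 1), p ≠ 4 →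
              C.ch (pad4Anchor E₀).X ((Scheme.Modules.pullback ι.left).obj G) p =
                ((c' p : ℚ) : ℂ) • cupPowTwo (symH d (pad4Action E₀ ψ₀) e a) p) ∧
            c' 1 ≠ 0) →
          foLift C (2 * 4) (pad4Anchor E₀).X ((Scheme.Modules.pullback ι.left).obj G)) := by
  sorry

/-- **STUB K — FIRST-ORDER K-THEORETIC DEFORMATIONAL HODGE ON ABELIAN FIBRES, Chern-character form — THE RUNG DESIGNATE.**
For every `C`, every finite locally free `E` on a complex abelian variety `X₀`, every smooth projective family `π : 𝒳 → S` over a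
smooth base with `X₀ ≅ X_{s₀}` on which all `C.ch_p(E)` (`p ≤ n`) stay of Hodge type under transport over a cohomologically locally
trivial open `U ∋ s₀`, and every square-zero Artinian point `Spec A → S` centred at `s₀` with thickening `j_A : X₀ ↪ X_A`: there are
finite locally free `Fp, Fm` ON `X_A` and `N > 0` with `C.ch(j_A^*Fp) = C.ch(j_A^*Fm) + N·C.ch(E)`.  One-parameter case (genuine
`ch`): Bloch–Esnault–Kerz 2014 Thm. 2 ((i) ⇒ (ii): the Hodge classes are flat in `F^p` to ALL orders along `Spf 𝒪̂_{S,s₀}` because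
the base is reduced; (CK) for the abelian scheme by Deninger–Murre after an étale-local section; project the pro-class to `K₀(X₂)_ℚ`
and clear denominators; `K₀` is generated by bundles) = Morrow 2014 Thm. 1.1 integrally over `ℚ̄`.  Multi-parameter case: the
extrapolation named in the module docstring.  Size XL.
[cite: BlochEsnaultKerz2014CharZero, Thm. 2, Rem. 1, Rem. 3] [cite: Morrow2014DeformationalHodge, Thm. 1.1, Thm. 3.2] -/
theorem stub_firstOrderKLift_abelian :
    ∀ (C : ChernCharacterBetti) (X₀ : SchemeOver ℂ), (∃ P₀ : AbelianVariety ℂ, Nonempty (X₀ ≅ P₀.X)) →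
      ∀ (E : X₀.left.Modules), IsFiniteLocallyFree E →
      ∀ ⦃𝒳 S : SchemeOver ℂ⦄ (π : 𝒳 ⟶ S) (n : ℕ), IsSmoothProjectiveFamily π n → Smooth S.hom →
      ∀ ⦃U : Set (ComplexPoints S)⦄ (hU : IsCohomologicallyLocallyTrivialOn π U) (s₀ : U)
        (e : X₀ ≅ fiberOver π s₀.1),
      (∀ p ∈ Finset.range (n + 1), ∀ (t : U) (γ : Path.Homotopic.Quotient s₀ t),
        IsOfHodgeType n (fiberOver π t.1) (2 * p) p p
          (transportFun π (2 * p) hU γ (complexBetti.map e.inv (2 * p) (C.ch X₀ E p)))) →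
      ∀ (A : Type) [CommRing A] [Algebra ℂ A] [IsArtinianRing A] [IsLocalRing A],
      IsLocalRing.maximalIdeal A * IsLocalRing.maximalIdeal A = ⊥ →
      ∀ (ρ : A →ₐ[ℂ] ℂ) (aS : specOver ℂ A ⟶ S),
      Spec.map (CommRingCat.ofHom ρ.toRingHom) ≫ aS.left = s₀.1.left →
      ∀ ⦃XA : Scheme⦄ (gA : XA ⟶ 𝒳.left) (qA : XA ⟶ Spec (CommRingCat.of A)),
      IsPullback gA qA π.left aS.left →
      ∀ (jA : X₀.left ⟶ XA), IsPullback jA X₀.hom qA (Spec.map (CommRingCat.ofHom ρ.toRingHom)) →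
      jA ≫ gA = e.hom.left ≫ (fiberι π s₀.1).left →
      ∃ (N : ℕ) (Fp Fm : XA.Modules), 0 < N ∧ IsFiniteLocallyFree Fp ∧ IsFiniteLocallyFree Fm ∧
        ∀ p : ℕ, C.ch X₀ ((Scheme.Modules.pullback jA).obj Fp) p =
          C.ch X₀ ((Scheme.Modules.pullback jA).obj Fm) p + (N : ℂ) • C.ch X₀ E p := by
  sorry

/-! ## §4 The composition (no sorry below) -/

section Composition

variable (C : ChernCharacterBetti)

/-- Whitney along a restriction: `C.ch(ι^*(F ⊞ G)) = C.ch(ι^*F) + C.ch(ι^*G)` for finite locally free `F, G`.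
[cite: Fulton1998, Example 3.2.3, §15.1 (ii)] -/
theorem ch_pullback_biprod {X Y : SchemeOver ℂ} (ι : Y ⟶ X) (F G : X.left.Modules) (hF : IsFiniteLocallyFree F)
    (hG : IsFiniteLocallyFree G) (p : ℕ) :
    C.ch Y ((Scheme.Modules.pullback ι.left).obj (F ⊞ G)) p =
      C.ch Y ((Scheme.Modules.pullback ι.left).obj F) p + C.ch Y ((Scheme.Modules.pullback ι.left).obj G) p := by
  rw [← C.map_ch ι (F ⊞ G) (KZero.isFiniteLocallyFree_biprod hF hG).isVectorBundle p,
    C.ch_biprod F G hF.isVectorBundle hG.isVectorBundle p, map_add, C.map_ch ι F hF.isVectorBundle p,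
    C.map_ch ι G hG.isVectorBundle p]

/-- The Serre display computes the restricted Chern character of the quotient:
`C.ch(ι^*Q) = (k+1)·C.ch(ι^*L) − C.ch(ι^*Fm)` for `0 → Fm → L^{⊕(k+1)} → Q → 0`. [cite: Fulton1998, Example 3.2.3] -/
theorem ch_pullback_serreQuotient {X Y : SchemeOver ℂ} (ι : Y ⟶ X) {F L Q : X.left.Modules}
    (hF : IsFiniteLocallyFree F) (hL : IsFiniteLocallyFree L) (hQ : IsFiniteLocallyFree Q) (k : ℕ)
    (i : F ⟶ (List.replicate k L).foldr (· ⊞ ·) L) (π : (List.replicate k L).foldr (· ⊞ ·) L ⟶ Q) (w : i ≫ π = 0)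
    (hSE : (ShortComplex.mk i π w).ShortExact) (p : ℕ) :
    C.ch Y ((Scheme.Modules.pullback ι.left).obj Q) p =
      ((k + 1 : ℕ) : ℂ) • C.ch Y ((Scheme.Modules.pullback ι.left).obj L) p -
        C.ch Y ((Scheme.Modules.pullback ι.left).obj F) p := by
  have hl : ∀ E ∈ List.replicate k L, IsFiniteLocallyFree E := fun E hE ↦ by
    rw [List.eq_of_mem_replicate hE]; exact hL
  have hM : IsFiniteLocallyFree ((List.replicate k L).foldr (· ⊞ ·) L) := isFiniteLocallyFree_foldr_biprod hL _ hl
  have e3 : C.ch X ((List.replicate k L).foldr (· ⊞ ·) L) p = C.ch X F p + C.ch X Q p :=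
    C.ch_shortExact (ShortComplex.mk i π w) hSE hF.isVectorBundle hQ.isVectorBundle p
  have e4 : C.ch X ((List.replicate k L).foldr (· ⊞ ·) L) p = ((k + 1 : ℕ) : ℂ) • C.ch X L p := by
    rw [C.ch_foldr_biprod hL p _ hl, List.map_replicate, List.sum_replicate, Nat.cast_succ, add_smul, one_smul,
      Nat.cast_smul_eq_nsmul]
  have eQ : C.ch X Q p = ((k + 1 : ℕ) : ℂ) • C.ch X L p - C.ch X F p := by
    rw [← e4, e3]; abel
  rw [← C.map_ch ι Q hQ.isVectorBundle p, eQ, map_sub, map_smul, C.map_ch ι L hL.isVectorBundle p,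
    C.map_ch ι F hF.isVectorBundle p]

end Composition

/-- **COMPOSITION: `Serre ∧ U ∧ K ⟹ ∀ C d, 0 < d → HasHyperbolicSeedOn (foClass C) 4 d`** (all three binders consumed; the CM curve
from `exists_cmCurve_sqrt_neg d`, the class half from the tree). -/
theorem hasHyperbolicSeedOn_foClass (hS : Hartshorne1977_serre_subbundleOfTwists) (C : ChernCharacterBetti) (d : ℕ)
    (hd : 0 < d) : HasHyperbolicSeedOn (foClass C) 4 d := by
  obtain ⟨E₀, ψ₀, hE, hψ⟩ :=
    Literature.NumberTheory.EllipticCurves.CMEndomorphism.exists_cmCurve_sqrt_neg d hd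
  obtain ⟨e, a, w, ha, ha0, hhyp, hwW, hwr, hw0, hseed⟩ := kappaDesign_pad4_of_serre' hS C d hd E₀ ψ₀ hE hψ
  -- the class half: an f.l.f. κ-design `E` on `P := S_d⁴`
  obtain ⟨I, κ, q, c, h4I, hlf, hκ4, hκp⟩ := hseed
  obtain ⟨hI, hab, E, hEflf, hκE⟩ := hlf
  subst hI
  -- U: the universal first-order Weil thickening
  obtain ⟨𝒳, S, π, hπ, hSm, U, hU, s₀, eW, A, _, _, _, _, hm, ρ, aS, haS, 𝒳A, gA, qA, hpbA, ι, hpbι, hcompat, eA, 𝓛, h𝓛,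
    l, hH1, hH2, hLB, hPAD, hl1, hUL⟩ :=
    stub_universalWeilThickening_pad4 C d hd E₀ ψ₀ hE hψ e a ha ha0 hhyp
  -- the Hodge hypothesis for `E` along `π`
  have hHodge : ∀ p ∈ Finset.range (2 * 4 + 1), ∀ (t : U) (γ : Path.Homotopic.Quotient s₀ t),
      IsOfHodgeType (2 * 4) (fiberOver π t.1) (2 * p) p p
        (transportFun π (2 * p) hU γ (complexBetti.map eW.inv (2 * p) (C.ch (pad4Anchor E₀).X E p))) := by
    intro p hp t γ
    rw [← hκE p hp]
    by_cases hp4 : p = 4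
    · subst hp4
      rw [hκ4]
      exact hH2 q w hwW t γ
    · rw [hκp p hp hp4]
      exact hH1 p (c p) t γ
  -- K at the universal datum
  obtain ⟨N, Fp, Fm, hN, hFp, hFm, hch⟩ :=
    stub_firstOrderKLift_abelian C (pad4Anchor E₀).X hab E hEflf π (2 * 4) hπ hSm hU s₀ eW hHodge A hm ρ aS haS gA qA
      hpbA ι.left hpbι hcompat
  -- Serre on the thickening, for `Fm`
  obtain ⟨L₀, hL₀, k, Q, hQ, iS, pS, wS, hSES⟩ := hS eA Fm hFm
  have hL : IsFiniteLocallyFree ((Scheme.Modules.pullback eA.ι.left).obj L₀) := hL₀.isFiniteLocallyFree.pullback eA.ι.left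
  obtain ⟨c', hc'⟩ := hLB L₀ hL₀
  -- `G₀ := Fp ⊞ Q` and its restricted Chern character
  have hG₀ : IsFiniteLocallyFree (Fp ⊞ Q) := KZero.isFiniteLocallyFree_biprod hFp hQ
  have key : ∀ p : ℕ, C.ch (pad4Anchor E₀).X ((Scheme.Modules.pullback ι.left).obj (Fp ⊞ Q)) p =
      (N : ℂ) • C.ch (pad4Anchor E₀).X E p +
        ((((k + 1 : ℕ) : ℚ) * c' p : ℚ) : ℂ) • cupPowTwo (symH d (pad4Action E₀ ψ₀) e a) p := by
    intro p
    rw [ch_pullback_biprod C ι Fp Q hFp hQ p, ch_pullback_serreQuotient C ι hFm hL hQ k iS pS wS hSES p, hc' p, hch p]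
    push_cast
    module
  -- the padded bundle with non-zero `h¹`-coefficient
  obtain ⟨G, hG, q', c'', hG4, hGp, hc1⟩ : ∃ (G : 𝒳A.left.Modules) (_ : IsFiniteLocallyFree G) (q' : ℚ) (c'' : ℕ → ℚ),
      C.ch (pad4Anchor E₀).X ((Scheme.Modules.pullback ι.left).obj G) 4 =
        ((q' : ℚ) : ℂ) • cupPowTwo (symH d (pad4Action E₀ ψ₀) e a) 4 + (N : ℂ) • w ∧
      (∀ p ∈ Finset.range (2 * 4 + 1), p ≠ 4 →
        C.ch (pad4Anchor E₀).X ((Scheme.Modules.pullback ι.left).obj G) p =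
          ((c'' p : ℚ) : ℂ) • cupPowTwo (symH d (pad4Action E₀ ψ₀) e a) p) ∧
      c'' 1 ≠ 0 := by
    by_cases hx : (N : ℚ) * c 1 + ((k + 1 : ℕ) : ℚ) * c' 1 = 0
    · refine ⟨(Fp ⊞ Q) ⊞ 𝓛, KZero.isFiniteLocallyFree_biprod hG₀ h𝓛, (N : ℚ) * q + ((k + 1 : ℕ) : ℚ) * c' 4 + l 4,
        fun p ↦ (N : ℚ) * c p + ((k + 1 : ℕ) : ℚ) * c' p + l p, ?_, ?_, ?_⟩
      · rw [ch_pullback_biprod C ι (Fp ⊞ Q) 𝓛 hG₀ h𝓛 4, key 4, hPAD 4, ← hκE 4 h4I, hκ4]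
        push_cast
        module
      · intro p hp hp4
        rw [ch_pullback_biprod C ι (Fp ⊞ Q) 𝓛 hG₀ h𝓛 p, key p, hPAD p, ← hκE p hp, hκp p hp hp4]
        push_cast
        module
      · show (N : ℚ) * c 1 + ((k + 1 : ℕ) : ℚ) * c' 1 + l 1 ≠ 0
        rw [hx, zero_add]; exact hl1
    · refine ⟨Fp ⊞ Q, hG₀, (N : ℚ) * q + ((k + 1 : ℕ) : ℚ) * c' 4, fun p ↦ (N : ℚ) * c p + ((k + 1 : ℕ) : ℚ) * c' p,
        ?_, ?_, hx⟩
      · rw [key 4, ← hκE 4 h4I, hκ4]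
        push_cast
        module
      · intro p hp hp4
        rw [key p, ← hκE p hp, hκp p hp hp4]
        push_cast
        module
  -- the new Weil part `N·w`
  have hw'W : (N : ℂ) • w ∈ weilClassesOf (pad4Anchor E₀) (pad4Action E₀ ψ₀) 4 d := Submodule.smul_mem _ _ hwW
  have hw'r : IsRationalClass ((N : ℂ) • w) := by
    have h := hwr.smul (N : ℚ)
    rwa [Rat.cast_natCast] at h
  have hw'0 : (N : ℂ) • w ≠ 0 := smul_ne_zero (Nat.cast_ne_zero.mpr hN.ne') hw0
  -- the first-order clause for `E' := ι^*G` from U's universal lift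
  have hlift : foLift C (2 * 4) (pad4Anchor E₀).X ((Scheme.Modules.pullback ι.left).obj G) :=
    hUL G hG ⟨q', c'', (N : ℂ) • w, hw'W, hw'r, hw'0, hG4, hGp, hc1⟩
  -- assemble the seed and the hyperbolic datum
  refine ⟨pad4Anchor E₀, pad4Action E₀ ψ₀, e, a, (N : ℂ) • w, pad4Anchor_dim hE, pad4Action_comp_self hψ, ha, ha0, hhyp,
    hw'W, hw'r, hw'0, ?_⟩
  exact ⟨Finset.range (2 * 4 + 1), fun p ↦ C.ch (pad4Anchor E₀).X ((Scheme.Modules.pullback ι.left).obj G) p, q', c'', h4I,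
    foClass_intro C rfl hab (hG.pullback ι.left) (fun _ _ ↦ rfl) hlift, hG4, hGp⟩

/-- **THE SKELETON THEOREM (v5): the crux X2‴, concluded BY NAME, from the displayed Serre fact (its own antecedent), the class half
IN THE TREE and the two REGISTERED STUBS U, K** — `closed = false` until both are proved. -/
theorem FirstOrderWeilSeedsEightCS_of :
    Summit.HodgeConjecture.HodgeConjecture.Theses.FirstOrderSemiregularSeeds.FirstOrderWeilSeedsEightCS :=
  firstOrderWeilSeedsEightCS_iff.mpr fun hS C d hd => hasHyperbolicSeedOn_foClass hS C d hd

#print axioms kappaDesign_pad4_of_serre'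
#print axioms FirstOrderWeilSeedsEightCS_of

end Summit.HodgeConjecture.HodgeConjecture.Cruxes.FirstOrderWeilSeedsEightCS.BirthK

end
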